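import Literature.AlgebraicGeometry.HodgeTheory.WeilFamilyReachOfMonodromy
import HarnessLib

/-!
# Flat Weil sections and the polarization class of a Weil family through ANY base point, from special-unitary
# monodromy (Deligne, LNM 900, proof of Thm. 4.8 (a)–(c)) — pointwise, reach-free, no hyperbolicity

Family `hodge`, layer `Literature/AlgebraicGeometry/HodgeTheory`; theorems only (no definition, no named fact;
count-neutral, D-0026). Second reduction step for the named fact `weilFamilyReach_similar`
(`HodgeTheory/WeilFamilyReachSimilar`), after `HodgeTheory/WeilFamilyReachSimilarOfSystem`, and the pointwise
twin of `polarizedWeilSystem_of_unitaryMonodromyFamily` (`HodgeTheory/WeilFamilyReachOfMonodromy`, whose statement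
is quantified over HYPERBOLIC base points and carries a reach clause, although its proof uses neither: the
hyperbolicity of `(P, ψ₀, h_K)` and the reach clause are only passed through).

Given at ONE base point `(P, ψ₀)` (`dim P = 2n`, `ψ₀² = -d`, `d ≥ 1`, `n ≥ 1`): a smooth projective family
`f : 𝒳 → S` of relative dimension `2n`, embedded by `ι : 𝒳 ↪ ℙᴺ × S` over `S`, `S` irreducible smooth
quasi-projective, a chart `e' : P ≅ 𝒳_{s₀}`; a global endomorphism `g` of `𝒳` over `S` (the action of `√-d`)
inducing `ψ₀` on `P` through `e'` and, at every `s`, the `√-d` `Ψ_s` (`Ψ_s² = -d`) of an abelian `2n`-fold `Y_s`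
through a chart `ε_s : Y_s ≅ 𝒳_s` with BALANCED type `dim (V₊(Y_s) ∩ H^{1,0}) = n`; SPECIAL-UNITARY MONODROMY at
`s₀` — `det (γ_* | V_±) = 1` on the two eigenspaces of the fibre map of `g` for every loop `γ` at `s₀`
([vanGeemen1994HodgeAV] 5.9, 5.11 put `det(A) = 1` into the DEFINITION of `Γ_Λ ⊂ SU(n, n)`; for Deligne's
level-`n` group `Γ` of the proof of Thm. 4.8 it is DERIVED from the level structure — a standard step NOT printed
by Deligne, printed with proof as [Lange2023AbelianVarietiesComplex] Cor. 2.4.11; clause (4) of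
`HodgeTheory/WeilFamilyReachSimilarOfConstruction`); and a rational
`a' ∈ H²(ℙᴺ(ℂ); ℂ)`. THEN:

* `flatWeilSections_of_unitaryMonodromyAt` — **clause (c)**: through every Weil class `w` of `(P, ψ₀)` there is
  a FLAT SECTION `σ` of `R^{2n} f_* ℂ` over `S(ℂ)` (continuous into the étalé space `FiberClass f (2n)`,
  `σ(s₀) = e'^{-1 *} w`) whose value at every `s` is of Hodge type `(n, n)` and lies, read in the chart `ε_s`, in
  the Weil plane of `(Y_s, Ψ_s)`: the Weil line sections of the two eigen-local-systems exist because the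
  monodromy has determinant one (`exists_continuous_section_of_det_restrict_eq_one`), transport preserves the
  eigen-lines (`transportFun_mem_eigenLines`), and the type is `(n, n)` on each balanced chart (Deligne–Milne
  Prop. 4.4, `isOfHodgeType_of_mem_weilClassesOf`);
* `polarizationClass_of_embedding` — **clause (a)**: `H := (ι ≫ pr₁)^* a'` restricts on every fibre to a
  rational class of type `(1,1)` (pull-back of the hyperplane datum; [MumfordFogartyKirwan1994] Thm. 7.9:
  the family is a family of POLARIZED abelian varieties).

Proofs: those of `polarizedWeilSystem_of_unitaryMonodromyFamily` with the pass-through binders deleted (same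
lemmas, same order). Together with the polarization equation `e'^*(H|_{s₀}) = h_K` (an input) these are exactly the
hypotheses `hsec`, `hH`, `hH₀` of `weilFamilyReaches_of_polarizedWeilSystemAt_of_periodSurjective`
(`HodgeTheory/WeilFamilyReachSimilarOfSystem`), so that the class-wide reach package follows from the
unitary-monodromy construction data at a Weil-type base point plus period surjectivity [U]; the composition is
recorded on the Summits side (`Summits/Ventures/HSemireg/S4BridgeWeilFamilyReachSimilar.lean`).
Cell `pub-hsemireg`, track S4-PUSH lane (iii), seat s4-bridge-2 gen 10.

## References

* [Deligne1982HodgeCycles] P. Deligne (notes by J. S. Milne), Hodge cycles on abelian varieties, LNM 900 (1982),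
  Prop. 4.4, Thm. 4.8 and its proof (clauses (a)–(c); Milne's TeXed ed., rev. 2018, pp. 32–35).
* [Lange2023AbelianVarietiesComplex] H. Lange, Abelian Varieties over the Complex Numbers (2023), Cor. 2.4.11
  (the determinant-one step behind special-unitary monodromy; not printed by Deligne).
* [vanGeemen1994HodgeAV] B. van Geemen, LNM 1594 (1994), Lemma 5.2, 5.3–5.5, 5.8–5.11.
* [MumfordFogartyKirwan1994] D. Mumford, J. Fogarty, F. Kirwan, Geometric Invariant Theory, 3rd ed. (1994),
  Thm. 7.9–7.10.
* [VoisinHodgeII2003] C. Voisin, Hodge Theory and Complex Algebraic Geometry II (2003), Lemma 4.17, §3.1.2.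
* [VoisinHodgeI2002] C. Voisin, Hodge Theory and Complex Algebraic Geometry I (2002), §7.3.2, §11.1.2.
-/

noncomputable section

namespace Literature.AlgebraicGeometry.HodgeTheory

open CategoryTheory _root_.AlgebraicGeometry
open Literature.AlgebraicGeometry Literature.AlgebraicGeometry.Motives
open Literature.AlgebraicTopology.SingularHomology

/-- **Clause (a) — the relative polarization class of an embedded family.** For a smooth projective family
`f : 𝒳 → S` of relative dimension `k`, an `S`-morphism `ι : 𝒳 → ℙᴺ × S` and a rational class
`a' ∈ H²(ℙᴺ(ℂ); ℂ)`, the global class `H := (ι ≫ pr₁)^* a'` restricts on every complex fibre `𝒳_s` to a RATIONAL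
class of Hodge type `(1,1)` (pull-back of a rational algebraic class of `ℙᴺ` to the smooth projective fibre).
[cite: MumfordFogartyKirwan1994, Thm. 7.9–7.10] [cite: VoisinHodgeI2002, §7.3.2 and §11.1.2] -/
theorem polarizationClass_of_embedding {k : ℕ} {𝒳 S : SchemeOver ℂ} (f : 𝒳 ⟶ S)
    (hfam : IsSmoothProjectiveFamily f k) {N : ℕ}
    (ι : 𝒳 ⟶ CategoryTheory.MonoidalCategoryStruct.tensorObj (projectiveSpace N ℂ) S)
    {a' : complexBetti (projectiveSpace N ℂ) 2} (ha' : IsRationalClass a') (s : ComplexPoints S) :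
    IsRationalClass (complexBetti.map (fiberι f s) 2
        (complexBetti.map (ι ≫ CategoryTheory.CartesianMonoidalCategory.fst (projectiveSpace N ℂ) S) 2 a')) ∧
      IsOfHodgeType k (fiberOver f s) 2 1 1 (complexBetti.map (fiberι f s) 2
        (complexBetti.map (ι ≫ CategoryTheory.CartesianMonoidalCategory.fst (projectiveSpace N ℂ) S) 2 a')) := by
  have hPN : IsSmoothProjective N (projectiveSpace N ℂ) := isSmoothProjective_projectiveSpace' N
  have ha'11 : IsOfHodgeType N (projectiveSpace N ℂ) (2 * 1) 1 1 a' :=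
    isOfHodgeType_of_mem_algebraicClasses_of_isSmoothProjective hPN 1
      (by rw [algebraicClasses_projectiveSpace_eq_top]; exact Submodule.mem_top)
  have hHs : complexBetti.map (fiberι f s) 2
      (complexBetti.map
        (ι ≫ CategoryTheory.CartesianMonoidalCategory.fst (projectiveSpace N ℂ) S) 2 a') =
      complexBetti.map
        (fiberι f s ≫ ι ≫ CategoryTheory.CartesianMonoidalCategory.fst (projectiveSpace N ℂ) S)
        2 a' := by
    rw [complexBetti.map_comp (fiberι f s), ModuleCat.comp_apply]
  rw [hHs]
  exact ⟨ha'.map _, ha'11.map_of_isSmoothProjective (hfam.isSmoothProjective s) hPN _⟩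

/-- **Clause (c) — flat Weil sections from special-unitary monodromy, through ANY base point with balanced
charts** (pointwise, reach-free twin of `polarizedWeilSystem_of_unitaryMonodromyFamily`; proof verbatim, pass-through
binders deleted). Data: `f : 𝒳 → S` smooth projective of relative dimension `2n` (no embedding needed here), `S`
irreducible smooth quasi-projective; `e' : P ≅ 𝒳_{s₀}` with `dim P = 2n`, `ψ₀² = -d` (`n, d ≥ 1`); a global
`√-d` `g` over `S` inducing `ψ₀` through `e'` and the `Ψ_s` of the balanced charts `ε_s : Y_s ≅ 𝒳_s`; monodromy at
`s₀` of determinant one on both eigenspaces of the fibre map of `g` (special-unitary monodromy — `Γ_Λ ⊂ SU(n, n)` by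
definition in [vanGeemen1994HodgeAV] 5.9, 5.11; derived from a level structure in clause (4) of
`HodgeTheory/WeilFamilyReachSimilarOfConstruction`). THEN through
every Weil class `w` of `(P, ψ₀)` there is a continuous section `σ` of `FiberClass f (2n)` with
`σ(s₀) = e'^{-1 *} w` whose value at every `s` is of Hodge type `(n, n)` (Deligne–Milne Prop. 4.4 on the balanced
chart) and lies, read in `ε_s`, in the Weil plane of `(Y_s, Ψ_s)` — the Weil-line sections of the eigen-systems
(`exists_continuous_section_of_det_restrict_eq_one`) transported from `e'^{-1 *} w`
(`map_inv_mem_eigenLines_of_mem_weilClassesOf`, `transportFun_mem_eigenLines`,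
`map_mem_weilClassesOf_of_mem_eigenLines`). No hyperbolicity, no reach clause.
[cite: Deligne1982HodgeCycles, §4 Prop. 4.4 and proof of Thm. 4.8, clause (c) (Milne's TeXed ed., rev. 2018, pp. 32–35)]
[cite: vanGeemen1994HodgeAV, Lemma 5.2 (4), 5.9 and 5.8–5.11] [cite: VoisinHodgeII2003, Lemma 4.17 and §3.1.2] -/
theorem flatWeilSections_of_unitaryMonodromyAt {n d : ℕ} (hn : 0 < n) (hd : 0 < d)
    {P : AbelianVariety ℂ} {ψ₀ : P ⟶ P} (hP : P.dim = 2 * n) (hψ : ψ₀ ≫ ψ₀ = -(d • 𝟙 P))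
    {𝒳 S : SchemeOver ℂ} (f : 𝒳 ⟶ S) (g : 𝒳 ⟶ 𝒳) {s₀ : ComplexPoints S} (e' : P.X ≅ fiberOver f s₀)
    (Y : ComplexPoints S → AbelianVariety ℂ) (Ψ : ∀ s, Y s ⟶ Y s) (ε : ∀ s, (Y s).X ≅ fiberOver f s)
    (hfam : IsSmoothProjectiveFamily f (2 * n))
    (hirr : IrreducibleSpace S.left) (hsm : AlgebraicGeometry.Smooth S.hom) (hqp : IsQuasiProjectiveOver S)
    (hg : g ≫ f = f) (he' : (e'.hom ≫ fiberι f s₀) ≫ g = ψ₀.hom.hom.hom ≫ (e'.hom ≫ fiberι f s₀))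
    (hfib : ∀ s, (Y s).dim = 2 * n ∧ Ψ s ≫ Ψ s = -((d : ℤ) • 𝟙 (Y s)) ∧
      ((ε s).hom ≫ fiberι f s) ≫ g = (Ψ s).hom.hom.hom ≫ ((ε s).hom ≫ fiberι f s) ∧
      ∀ hY : IsSmoothProjective (2 * n) (Y s).X,
        Module.finrank ℂ
          ↥(Module.End.eigenspace (complexBetti.map (Ψ s).hom.hom.hom 1).hom
              (Complex.I * (Real.sqrt d : ℂ)) ⊓ hodgeOneZero hY) = n)
    (hdet : ∀ (hU : IsCohomologicallyLocallyTrivialOn f (Set.univ : Set (ComplexPoints S)))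
        (g₀ : fiberOver f s₀ ⟶ fiberOver f s₀), g₀ ≫ fiberι f s₀ = fiberι f s₀ ≫ g →
      ∀ (γ : Path.Homotopic.Quotient
          (⟨s₀, Set.mem_univ s₀⟩ : (Set.univ : Set (ComplexPoints S))) ⟨s₀, Set.mem_univ s₀⟩)
        (μ : ℂ), (μ = Complex.I * (Real.sqrt d : ℂ) ∨ μ = -(Complex.I * (Real.sqrt d : ℂ))) →
      ∀ hμ : ∀ v ∈ Module.End.eigenspace (complexBetti.map g₀ 1).hom μ,
          transportLinear f 1 hU γ v ∈ Module.End.eigenspace (complexBetti.map g₀ 1).hom μ,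
        LinearMap.det ((transportLinear f 1 hU γ).restrict hμ) = 1) :
    ∀ w : complexBetti P.X (2 * n), w ∈ weilClassesOf P ψ₀ n d →
      ∃ σ : ComplexPoints S → FiberClass f (2 * n),
        Continuous σ ∧ σ s₀ = ⟨s₀, complexBetti.map e'.inv (2 * n) w⟩ ∧
        ∀ s, ∃ x : complexBetti (fiberOver f s) (2 * n), σ s = ⟨s, x⟩ ∧
          IsOfHodgeType (2 * n) (fiberOver f s) (2 * n) n n x ∧
          complexBetti.map (ε s).hom (2 * n) x ∈ weilClassesOf (Y s) (Ψ s) n d := by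
  have hn0 : 0 < n := hn
  have hd0 : 0 < d := hd
  have hψ' : ψ₀ ≫ ψ₀ = -(d • 𝟙 P) := hψ
  -- the base: `S(ℂ)` is a path-connected, locally path-connected manifold and `Rᵏ f_* ℂ` is a
  -- local system on it (Ehresmann)
  haveI := hsm
  haveI := hirr
  haveI : LocallyOfFiniteType S.hom := hqp.locallyOfFiniteType
  haveI : ConnectedSpace (ComplexPoints S) :=
    (Motives.ComplexPoints.connectedSpace_iff_holds S).2 inferInstance
  obtain ⟨dS, hdS⟩ := exists_smoothOfRelativeDimension_of_connectedSpace_complexPoints S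
  haveI := hdS
  haveI := pathConnectedSpace_complexPoints_of_smoothOfRelativeDimension S dS
  letI := Motives.ComplexPoints.chartedSpace S dS
  haveI : LocallyPathConnectedSpace (ComplexPoints S) :=
    ChartedSpace.locallyPathConnectedSpace (EuclideanSpace ℝ (Fin (2 * dS))) (ComplexPoints S)
  have hU := isCohomologicallyLocallyTrivialOn_univ_of_isSmoothProjectiveFamily f dS hfam hqp
  -- the fibre maps of `g`
  have hgf' := fun t ↦ exists_fiberHom_comp_fiberι f g hg t
  choose gf hgf using hgf'
  have he₀ : e'.hom ≫ gf s₀ = ψ₀.hom.hom.hom ≫ e'.hom :=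
    hom_comp_fiberHom_eq_of_comp_fiberι f g (hgf s₀) e' ψ₀.hom.hom.hom he'
  -- the cohomological Weil plane of the fibre over `t`
  let WP : ∀ t : ComplexPoints S, Submodule ℂ (complexBetti (fiberOver f t) (2 * n)) :=
    fun t ↦
      Submodule.span ℂ
        {x | ∃ w : Fin (2 * n) → complexBetti (fiberOver f t) 1,
          (∀ i, w i ∈ Module.End.eigenspace (complexBetti.map (gf t) 1).hom
            (Complex.I * (Real.sqrt d : ℂ))) ∧
          cupPowOne ℂ (ComplexPoints (fiberOver f t)) (2 * n) w = x} ⊔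
      Submodule.span ℂ
        {x | ∃ w : Fin (2 * n) → complexBetti (fiberOver f t) 1,
          (∀ i, w i ∈ Module.End.eigenspace (complexBetti.map (gf t) 1).hom
            (-(Complex.I * (Real.sqrt d : ℂ)))) ∧
          cupPowOne ℂ (ComplexPoints (fiberOver f t)) (2 * n) w = x}
  -- the eigenspaces `V_{±i√d}` of `g_{s₀}^*` on `H¹(𝒳_{s₀})` have dimension `2n` (read on `P`)
  have hrk : ∀ μ : ℂ, (μ = Complex.I * (Real.sqrt d : ℂ) ∨ μ = -(Complex.I * (Real.sqrt d : ℂ))) →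
      Module.finrank ℂ ↥(Module.End.eigenspace (complexBetti.map (gf s₀) 1).hom μ) = 2 * n := by
    intro μ hμ
    rw [finrank_eigenspace_eq_of_chart_comm e' (gf s₀) he₀ 1 μ]
    have hb₁ : Module.finrank ℂ (complexBetti P.X 1) = 2 * (2 * n) := by
      rw [Motives.AbelianVariety.finrank_complexBetti_one, hP]
    have hps : Module.finrank ℂ ↥(Module.End.eigenspace (complexBetti.map ψ₀.hom.hom.hom 1).hom
        (Complex.I * (Real.sqrt d : ℂ))) = 2 * n := by
      have h2 := two_mul_finrank_eigenspace_eq hd0 hψ'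
      rw [hb₁] at h2
      omega
    rcases hμ with rfl | rfl
    · exact hps
    · rw [← finrank_eigenspace_eq_finrank_eigenspace_neg hd0 hψ', hps]
  haveI : Module.Finite ℂ ↥(Module.End.eigenspace (complexBetti.map (gf s₀) 1).hom
      (Complex.I * (Real.sqrt d : ℂ))) :=
    Module.finite_of_finrank_pos (by rw [hrk _ (Or.inl rfl)]; omega)
  haveI : Module.Finite ℂ ↥(Module.End.eigenspace (complexBetti.map (gf s₀) 1).hom
      (-(Complex.I * (Real.sqrt d : ℂ)))) :=
    Module.finite_of_finrank_pos (by rw [hrk _ (Or.inr rfl)]; omega)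
  let bμ := Module.finBasisOfFinrankEq ℂ
    ↥(Module.End.eigenspace (complexBetti.map (gf s₀) 1).hom (Complex.I * (Real.sqrt d : ℂ)))
    (hrk _ (Or.inl rfl))
  let bν := Module.finBasisOfFinrankEq ℂ
    ↥(Module.End.eigenspace (complexBetti.map (gf s₀) 1).hom (-(Complex.I * (Real.sqrt d : ℂ))))
    (hrk _ (Or.inr rfl))
  -- flat sections through every Weil class of `P`, Weil-valued and of type `(n, n)` everywhere
  intro w hw
  have hα : complexBetti.map e'.inv (2 * n) w ∈ WP s₀ :=
    map_inv_mem_eigenLines_of_mem_weilClassesOf e' (gf s₀) hd0 hP hψ' he₀ hw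
  obtain ⟨σ, hσ, hpt, hσ₀⟩ := exists_continuous_section_of_det_restrict_eq_one f hU g hg gf hgf s₀
    (Complex.I * (Real.sqrt d : ℂ)) (-(Complex.I * (Real.sqrt d : ℂ))) bμ bν
    (fun γ ↦ ⟨hdet hU (gf s₀) (hgf s₀) γ _ (Or.inl rfl)
        (fun _ hv ↦ transportFun_mem_eigenspace_fiberHom f 1 hU g hg gf hgf γ hv),
      hdet hU (gf s₀) (hgf s₀) γ _ (Or.inr rfl)
        (fun _ hv ↦ transportFun_mem_eigenspace_fiberHom f 1 hU g hg gf hgf γ hv)⟩) hα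
  refine ⟨σ, hσ, hσ₀, fun s ↦ ?_⟩
  -- the value at `s` is the transport of `e'^{-1 *} w`, hence in the Weil plane of `𝒳_s`
  have key : (σ s).clsAt (hpt s) ∈ WP s := by
    let γ : Path (⟨s₀, Set.mem_univ s₀⟩ : (Set.univ : Set (ComplexPoints S))) ⟨s, Set.mem_univ s⟩ :=
      (PathConnectedSpace.somePath s₀ s).map (continuous_id.subtype_mk _)
    have htr := transportFun_clsAt_of_continuous f (2 * n) hU hσ hpt γ
    have h0 : (σ s₀).clsAt (hpt s₀) = complexBetti.map e'.inv (2 * n) w := by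
      rw [FiberClass.clsAt_eq_iff]; exact hσ₀
    change transportFun f (2 * n) hU ⟦γ⟧ ((σ s₀).clsAt (hpt s₀)) = (σ s).clsAt (hpt s) at htr
    rw [← htr, h0]
    exact transportFun_mem_eigenLines f hU g hg gf hgf ⟦γ⟧ _ _ (2 * n) hα
  obtain ⟨hYd, hΨ, hεg, hbal⟩ := hfib s
  have hΨ' : Ψ s ≫ Ψ s = -(d • 𝟙 (Y s)) := by rw [hΨ, natCast_zsmul]
  have hεs : (ε s).hom ≫ gf s = (Ψ s).hom.hom.hom ≫ (ε s).hom :=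
    hom_comp_fiberHom_eq_of_comp_fiberι f g (hgf s) (ε s) (Ψ s).hom.hom.hom hεg
  have hmemA : complexBetti.map (ε s).hom (2 * n) ((σ s).clsAt (hpt s)) ∈
      weilClassesOf (Y s) (Ψ s) n d :=
    map_mem_weilClassesOf_of_mem_eigenLines (ε s) (gf s) hεs key
  refine ⟨(σ s).clsAt (hpt s), (FiberClass.mk_clsAt _ _).symm, ?_, hmemA⟩
  -- of type `(n, n)`: Prop. 4.4 on the balanced chart `(Y_s, Ψ_s)`, carried back along `ε_s`
  have htyp := (isOfHodgeType_of_mem_weilClassesOf hn0 hYd hd0 hΨ' (hbal _) hmemA).map_of_iso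
    (ε s).symm
  have hid : singularCohomology.map ℂ ℂ (Motives.AlgPoints.mapContinuous (L := ℂ) (ε s).symm.hom)
      (2 * n) (complexBetti.map (ε s).hom (2 * n) ((σ s).clsAt (hpt s))) = (σ s).clsAt (hpt s) := by
    change complexBetti.map (ε s).inv (2 * n) (complexBetti.map (ε s).hom (2 * n) _) = _
    rw [← ModuleCat.comp_apply, ← complexBetti.map_comp, (ε s).inv_hom_id, complexBetti.map_id]
    rfl
  rw [hid] at htyp
  exact htyp

end Literature.AlgebraicGeometry.HodgeTheory

end
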